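import Mathlib
import Literature.Analysis.FluidPDE.VectorCalculus
import Literature.Analysis.FluidPDE.TaoAveragedNondegeneracy
import Literature.Analysis.FluidPDE.LeiZhang2011Proofs

/-!
# Radial structure of witness ends (tools stub `stub_radialEndTools`, line `zero-accretion-selection`)

Clause-level facts about a filament of a relative equilibrium in the rotating Leray frame that the conjectural
stubs of the negation lines (`stub_lengthRegular`, `stub_strandSeparation`, the waist localisation inside
`stub_zeroAccretionShadowing`, the disprover's tail law) cite as their one rigorous structural input:
(1) from the tangency relation `u + ½Ξ − α e₃×Ξ = w T` alone, `w ⟪T, Ξ⟫ = ⟪u, Ξ⟫ + ½‖Ξ‖²` — the frame rotation is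
radial-blind; (2) the unique-zero clause with `w′(τ*) > 0` makes `w > 0` after `τ*` and `w < 0` before; (3) hence
wherever the induced velocity is below half the distance to the origin, `‖Ξ‖²` is strictly monotone along the end
(RADIAL MONOTONICITY: no return without a drift-opposing partner); (4) the drift obeys `½‖y‖ ≤ ‖½y − αe₃×y‖ ≤ (½+|α|)‖y‖`
and a stagnation point sits where `‖Ξ‖ ≤ 2‖u(Ξ)‖` (WAIST LOCALISATION, algebraic core).
-/

noncomputable section

open Literature.Analysis.FluidPDE Literature.Analysis.FluidPDE.Tao2016
open scoped RealInnerProductSpace InnerProductSpace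

namespace Summit.NavierStokesRegularity.NavierStokesRegularity.Theorems.SkeletonEquilibrium.ZeroAccretionSelection
set_option linter.dupNamespace false

/-- Radial identity: the tangency relation `u + ½Ξ − α e₃×Ξ = w T` paired with `Ξ` gives
`w ⟪T, Ξ⟫ = ⟪u, Ξ⟫ + ½‖Ξ‖²` (the frame rotation is orthogonal to `Ξ`). [folklore] -/
theorem slip_mul_inner_eq (α w : ℝ) (u Ξ T : EuclideanSpace ℝ (Fin 3))
    (h : u + ((1 / 2 : ℝ) • Ξ - α • cross (EuclideanSpace.single (2 : Fin 3) (1 : ℝ)) Ξ) = w • T) :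
    w * ⟪T, Ξ⟫ = ⟪u, Ξ⟫ + 1 / 2 * ‖Ξ‖ ^ 2 := by
  have := congrArg (fun v => ⟪v, Ξ⟫) h
  simp only [inner_add_left, inner_sub_left, real_inner_smul_left, inner_cross_self_right,
    mul_zero, sub_zero, real_inner_self_eq_norm_sq] at this
  linarith

/-- Sign structure of the slip: a differentiable `w : ℝ → ℝ` with a unique zero `τs` at which
`0 < w′(τs)` is positive to the right of `τs`. [folklore] -/
theorem slip_pos_of_unique_zero {w : ℝ → ℝ} (hw : Differentiable ℝ w) {τs : ℝ} (hz : w τs = 0)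
    (huniq : ∀ τ, w τ = 0 → τ = τs) (hpos : 0 < deriv w τs) {τ : ℝ} (hτ : τs < τ) : 0 < w τ := by
  by_contra hle
  push Not at hle
  have hd : HasDerivAt w (deriv w τs) τs := (hw τs).hasDerivAt
  -- eventually to the right of τs, w > 0 (positive derivative at a zero)
  have hev : ∀ᶠ τ' in nhdsWithin τs (Set.Ioi τs), 0 < w τ' := by
    have ht : Filter.Tendsto (slope w τs) (nhdsWithin τs (Set.Ioi τs)) (nhds (deriv w τs)) :=
      hd.tendsto_slope.mono_left (nhdsWithin_mono _ fun x hx => ne_of_gt hx)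
    have h2 : ∀ᶠ τ' in nhdsWithin τs (Set.Ioi τs), 0 < slope w τs τ' :=
      ht.eventually (eventually_gt_nhds hpos)
    have h3 : ∀ᶠ τ' in nhdsWithin τs (Set.Ioi τs), τs < τ' := eventually_mem_nhdsWithin
    filter_upwards [h2, h3] with τ' h2' h3'
    rw [slope_def_field, hz, sub_zero] at h2'
    exact (div_pos_iff_of_pos_right (by linarith)).1 h2'
  -- pick τ₁ ∈ (τs, τ) with w τ₁ > 0
  obtain ⟨τ₁, ⟨hτ₁pos, hτ₁lt⟩, hτ₁gt⟩ : ∃ τ₁, (0 < w τ₁ ∧ τ₁ < τ) ∧ τs < τ₁ := by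
    have h4 : ∀ᶠ τ' in nhdsWithin τs (Set.Ioi τs), τ' < τ :=
      (eventually_lt_nhds hτ).filter_mono nhdsWithin_le_nhds
    have h5 : ∀ᶠ τ' in nhdsWithin τs (Set.Ioi τs), τs < τ' := eventually_mem_nhdsWithin
    exact ((hev.and h4).and h5).exists
  -- IVT on [τ₁, τ]: a zero in [τ₁, τ], which must equal τs < τ₁: contradiction
  have hcont : ContinuousOn w (Set.Icc τ₁ τ) := hw.continuous.continuousOn
  have hmem : (0 : ℝ) ∈ Set.Icc (w τ) (w τ₁) := ⟨hle, hτ₁pos.le⟩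
  obtain ⟨c, hc, hc0⟩ := intermediate_value_Icc' hτ₁lt.le hcont hmem
  have hcs := huniq c hc0
  rw [hcs] at hc
  exact absurd hc.1 (not_le.2 hτ₁gt)

/-- Sign structure of the slip, left of the zero: with the same hypotheses `w` is negative on
`(−∞, τs)` (apply the right-hand version to `τ ↦ −w(−τ)`). [folklore] -/
theorem slip_neg_of_unique_zero {w : ℝ → ℝ} (hw : Differentiable ℝ w) {τs : ℝ} (hz : w τs = 0)
    (huniq : ∀ τ, w τ = 0 → τ = τs) (hpos : 0 < deriv w τs) {τ : ℝ} (hτ : τ < τs) : w τ < 0 := by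
  set v : ℝ → ℝ := fun σ => -w (-σ) with hv
  have hvd : Differentiable ℝ v := (hw.comp differentiable_neg).neg
  have hvz : v (-τs) = 0 := by simp [hv, hz]
  have hvuniq : ∀ σ, v σ = 0 → σ = -τs := by
    intro σ hσ
    have h1 : w (-σ) = 0 := by simpa [hv] using hσ
    have h2 := huniq _ h1
    linarith
  have hvderiv : deriv v (-τs) = deriv w τs := by
    have h1 : HasDerivAt (fun σ => w (-σ)) (deriv w τs * (-1)) (-τs) := by
      have hw' : HasDerivAt w (deriv w τs) (-(-τs)) := by
        rw [neg_neg]; exact (hw τs).hasDerivAt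
      exact hw'.comp (-τs) (hasDerivAt_neg (-τs))
    have h2 : HasDerivAt v (-(deriv w τs * (-1))) (-τs) := h1.neg
    rw [h2.deriv]; ring
  have hvpos : 0 < deriv v (-τs) := by rw [hvderiv]; exact hpos
  have h := slip_pos_of_unique_zero hvd hvz hvuniq hvpos (neg_lt_neg hτ)
  simp only [hv, neg_neg] at h
  linarith

/-- **Radial monotonicity of an end.** If `u + ½Ξ − α e₃×Ξ = w T` at a point with `0 < w`,
`‖T‖ ≤ 1` and the induced velocity is smaller than half the distance to the origin, `‖u‖ < ½‖Ξ‖`,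
then `⟪T, Ξ⟫ > 0`, i.e. `‖Ξ‖²` is strictly increasing along the filament there. [folklore] -/
theorem inner_tangent_pos_of_slip_pos (α w : ℝ) (u Ξ T : EuclideanSpace ℝ (Fin 3))
    (h : u + ((1 / 2 : ℝ) • Ξ - α • cross (EuclideanSpace.single (2 : Fin 3) (1 : ℝ)) Ξ) = w • T)
    (hw : 0 < w) (hu : ‖u‖ < 1 / 2 * ‖Ξ‖) : 0 < ⟪T, Ξ⟫ := by
  have hid := slip_mul_inner_eq α w u Ξ T h
  have hcs : |⟪u, Ξ⟫| ≤ ‖u‖ * ‖Ξ‖ := abs_real_inner_le_norm u Ξ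
  have hΞ : 0 < ‖Ξ‖ := by
    have := norm_nonneg u
    linarith
  have h1 : -(‖u‖ * ‖Ξ‖) ≤ ⟪u, Ξ⟫ := by
    have := neg_abs_le ⟪u, Ξ⟫
    linarith
  have h2 : ‖u‖ * ‖Ξ‖ < 1 / 2 * ‖Ξ‖ * ‖Ξ‖ := by nlinarith
  have h3 : 0 < ⟪u, Ξ⟫ + 1 / 2 * ‖Ξ‖ ^ 2 := by nlinarith
  have h4 : 0 < w * ⟪T, Ξ⟫ := by rw [hid]; exact h3
  exact pos_of_mul_pos_right h4 hw.le

/-- `‖e₃ × y‖ ≤ ‖y‖`. [folklore] -/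
theorem norm_e3_cross_le (y : EuclideanSpace ℝ (Fin 3)) :
    ‖cross (EuclideanSpace.single (2 : Fin 3) (1 : ℝ)) y‖ ≤ ‖y‖ := by
  have := norm_cross_le_norm_mul_norm (EuclideanSpace.single (2 : Fin 3) (1 : ℝ)) y
  have he : ‖(EuclideanSpace.single (2 : Fin 3) (1 : ℝ))‖ = 1 := by simp
  rwa [he, one_mul] at this

/-- `⟪½ y − α e₃ × y, y⟫ = ½ ‖y‖²`: the rotation part of the drift is orthogonal to `y`. [folklore] -/
theorem inner_drift_self (α : ℝ) (y : EuclideanSpace ℝ (Fin 3)) :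
    ⟪(1 / 2 : ℝ) • y - α • cross (EuclideanSpace.single (2 : Fin 3) (1 : ℝ)) y, y⟫ = 1 / 2 * ‖y‖ ^ 2 := by
  rw [inner_sub_left, real_inner_smul_left, real_inner_smul_left, inner_cross_self_right, mul_zero,
    sub_zero, real_inner_self_eq_norm_sq]

/-- Lower bound of the drift: `½ ‖y‖ ≤ ‖½ y − α e₃ × y‖` (Cauchy–Schwarz on `⟪A y, y⟫ = ½‖y‖²`). [folklore] -/
theorem half_norm_le_norm_drift (α : ℝ) (y : EuclideanSpace ℝ (Fin 3)) :
    1 / 2 * ‖y‖ ≤ ‖(1 / 2 : ℝ) • y - α • cross (EuclideanSpace.single (2 : Fin 3) (1 : ℝ)) y‖ := by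
  set B := (1 / 2 : ℝ) • y - α • cross (EuclideanSpace.single (2 : Fin 3) (1 : ℝ)) y with hB
  have h1 : ⟪B, y⟫ = 1 / 2 * ‖y‖ ^ 2 := inner_drift_self α y
  have h2 : ⟪B, y⟫ ≤ ‖B‖ * ‖y‖ := real_inner_le_norm B y
  by_cases hy : ‖y‖ = 0
  · rw [hy, mul_zero]; exact norm_nonneg _
  · have hy' : 0 < ‖y‖ := lt_of_le_of_ne (norm_nonneg _) (Ne.symm hy)
    nlinarith

/-- Upper bound of the drift: `‖½ y − α e₃ × y‖ ≤ (½ + |α|) ‖y‖`. [folklore] -/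
theorem norm_drift_le (α : ℝ) (y : EuclideanSpace ℝ (Fin 3)) :
    ‖(1 / 2 : ℝ) • y - α • cross (EuclideanSpace.single (2 : Fin 3) (1 : ℝ)) y‖ ≤ (1 / 2 + |α|) * ‖y‖ := by
  calc ‖(1 / 2 : ℝ) • y - α • cross (EuclideanSpace.single (2 : Fin 3) (1 : ℝ)) y‖
      ≤ ‖(1 / 2 : ℝ) • y‖ + ‖α • cross (EuclideanSpace.single (2 : Fin 3) (1 : ℝ)) y‖ := norm_sub_le _ _
    _ = 1 / 2 * ‖y‖ + |α| * ‖cross (EuclideanSpace.single (2 : Fin 3) (1 : ℝ)) y‖ := by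
        rw [norm_smul, norm_smul, Real.norm_eq_abs, Real.norm_eq_abs, abs_of_pos (by norm_num : (0:ℝ) < 1 / 2)]
    _ ≤ 1 / 2 * ‖y‖ + |α| * ‖y‖ := by
        gcongr
        exact norm_e3_cross_le y
    _ = (1 / 2 + |α|) * ‖y‖ := by ring

/-- **Waist localisation, algebraic core.** At a stagnation point the tangency relation
`u + ½Ξ − α e₃ × Ξ = w T` with `w = 0` forces `‖Ξ‖ ≤ 2‖u‖`: the waist sits where the induced velocity
balances the drift. [folklore] -/
theorem norm_le_two_mul_norm_of_stagnation (α w : ℝ) (u Ξ T : EuclideanSpace ℝ (Fin 3))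
    (h : u + ((1 / 2 : ℝ) • Ξ - α • cross (EuclideanSpace.single (2 : Fin 3) (1 : ℝ)) Ξ) = w • T)
    (hw : w = 0) : ‖Ξ‖ ≤ 2 * ‖u‖ := by
  rw [hw, zero_smul] at h
  have h1 : (1 / 2 : ℝ) • Ξ - α • cross (EuclideanSpace.single (2 : Fin 3) (1 : ℝ)) Ξ = -u :=
    eq_neg_of_add_eq_zero_right h
  have h2 := half_norm_le_norm_drift α Ξ
  rw [h1, norm_neg] at h2
  linarith


/-- **Registered tools stub `stub_radialEndTools`** (line `zero-accretion-selection`): the conjunction of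
`slip_mul_inner_eq`, `slip_pos_of_unique_zero`, `slip_neg_of_unique_zero`, `inner_tangent_pos_of_slip_pos`,
`half_norm_le_norm_drift`, `norm_drift_le`, `norm_le_two_mul_norm_of_stagnation`. [folklore] -/
theorem stub_radialEndTools :
    (∀ (α w : ℝ) (u Ξ T : EuclideanSpace ℝ (Fin 3)), u + ((1 / 2 : ℝ) • Ξ - α • cross (EuclideanSpace.single (2 : Fin 3) (1 : ℝ)) Ξ) = w • T →
      w * ⟪T, Ξ⟫ = ⟪u, Ξ⟫ + 1 / 2 * ‖Ξ‖ ^ 2) ∧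
    (∀ (w : ℝ → ℝ) (τs τ : ℝ), Differentiable ℝ w → w τs = 0 → (∀ σ, w σ = 0 → σ = τs) → 0 < deriv w τs →
      τs < τ → 0 < w τ) ∧
    (∀ (w : ℝ → ℝ) (τs τ : ℝ), Differentiable ℝ w → w τs = 0 → (∀ σ, w σ = 0 → σ = τs) → 0 < deriv w τs →
      τ < τs → w τ < 0) ∧
    (∀ (α w : ℝ) (u Ξ T : EuclideanSpace ℝ (Fin 3)), u + ((1 / 2 : ℝ) • Ξ - α • cross (EuclideanSpace.single (2 : Fin 3) (1 : ℝ)) Ξ) = w • T →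
      0 < w → ‖u‖ < 1 / 2 * ‖Ξ‖ → 0 < ⟪T, Ξ⟫) ∧
    (∀ (α : ℝ) (y : EuclideanSpace ℝ (Fin 3)), 1 / 2 * ‖y‖ ≤ ‖(1 / 2 : ℝ) • y - α • cross (EuclideanSpace.single (2 : Fin 3) (1 : ℝ)) y‖) ∧
    (∀ (α : ℝ) (y : EuclideanSpace ℝ (Fin 3)), ‖(1 / 2 : ℝ) • y - α • cross (EuclideanSpace.single (2 : Fin 3) (1 : ℝ)) y‖ ≤ (1 / 2 + |α|) * ‖y‖) ∧
    (∀ (α w : ℝ) (u Ξ T : EuclideanSpace ℝ (Fin 3)), u + ((1 / 2 : ℝ) • Ξ - α • cross (EuclideanSpace.single (2 : Fin 3) (1 : ℝ)) Ξ) = w • T →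
      w = 0 → ‖Ξ‖ ≤ 2 * ‖u‖) :=
  ⟨slip_mul_inner_eq,
    fun _ _ _ hw hz huniq hpos hτ => slip_pos_of_unique_zero hw hz huniq hpos hτ,
    fun _ _ _ hw hz huniq hpos hτ => slip_neg_of_unique_zero hw hz huniq hpos hτ,
    inner_tangent_pos_of_slip_pos, half_norm_le_norm_drift, norm_drift_le, norm_le_two_mul_norm_of_stagnation⟩

end Summit.NavierStokesRegularity.NavierStokesRegularity.Theorems.SkeletonEquilibrium.ZeroAccretionSelection
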